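import Mathlib.Analysis.InnerProductSpace.Calculus
import Mathlib.Analysis.InnerProductSpace.PiL2
import Mathlib.Analysis.Calculus.FDeriv.Equiv
import HarnessLib

/-!
# Stub Z1 `stub_defect_rotate` for crux `MoebiusLimitExists` (stmt-CriticalPhenomena-1344), line `Sketch` v16
(lead prover-line-stmt-CriticalPhenomena-1344-c19-0; THEOREM-ONLY, `--supports stmt-CriticalPhenomena-1344`)

**`O(3)`-covariance of the pointwise special-conformal defect.** For one level `F : (ℝ³)ⁿ → ℝ`, a weight `Δ`
and a generator `b ∈ ℝ³`, the pointwise SCT defect is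
`E_b(F)(x) := DF(x)[(‖xᵢ‖² b − 2⟪b,xᵢ⟫ xᵢ)ᵢ] − 2Δ (Σᵢ ⟪b,xᵢ⟫) F(x)` (with Mathlib's `fderiv`, which is `0` where `F`
is not differentiable). If `F` is invariant under the diagonal action `R̂ : y ↦ (R yᵢ)ᵢ` of a linear isometry `R` of
`ℝ³`, then `E_{Rb}(F)(R̂ x) = E_b(F)(x)`.

Proof. `R̂ := ContinuousLinearEquiv.piCongrRight (fun _ => R)` is a continuous linear equivalence of `(ℝ³)ⁿ` with
`F ∘ R̂ = F`, so `DF(x) = D(F ∘ R̂)(x) = DF(R̂x) ∘ R̂` unconditionally (`ContinuousLinearEquiv.comp_right_fderiv`, which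
also covers the non-differentiable case where both sides are `0`). Since `R` is linear with `‖Ry‖ = ‖y‖` and
`⟪Rb, Ry⟫ = ⟪b, y⟫`, `R̂` maps the configuration field `(‖xᵢ‖² b − 2⟪b,xᵢ⟫ xᵢ)ᵢ` to
`(‖Rxᵢ‖² Rb − 2⟪Rb,Rxᵢ⟫ Rxᵢ)ᵢ`, and the scalar terms agree by `⟪Rb, Rxᵢ⟫ = ⟪b, xᵢ⟫` and `F(R̂x) = F(x)`.

References: standard (conformal algebra, `K_{Rb}(Ry) = R K_b(y)`; Di Francesco–Mathieu–Sénéchal §4.1). No definitions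
are introduced.
-/

namespace Summit.CriticalPhenomena.Ising3DConformalLimit.MoebiusLimitExistsSketchV16

/-- **Stub Z1 — `stub_defect_rotate`** (registered signature). For a level `F : (ℝ³)ⁿ → ℝ` invariant under the
diagonal action of a linear isometry `R` of `ℝ³` (`F (R yᵢ)ᵢ = F y`), the pointwise special-conformal defect
`E_b(F)(x) = DF(x)[(‖xᵢ‖² b − 2⟪b,xᵢ⟫ xᵢ)ᵢ] − 2Δ (Σᵢ ⟪b,xᵢ⟫) F(x)` is `O(3)`-covariant:
`E_{Rb}(F)(R̂ x) = E_b(F)(x)`. No differentiability hypothesis (Mathlib's `fderiv` is `0` at points of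
non-differentiability, and differentiability at `x` and at `R̂ x` are equivalent). Proof: chain rule through the
continuous linear equivalence `R̂ = ContinuousLinearEquiv.piCongrRight (fun _ => R)` with `F ∘ R̂ = F`, plus
`‖R y‖ = ‖y‖`, `⟪R b, R y⟫ = ⟪b, y⟫`. [folklore] -/
theorem stub_defect_rotate : ∀ (n : ℕ) (F : (Fin n → EuclideanSpace ℝ (Fin 3)) → ℝ) (Δ : ℝ)
    (R : EuclideanSpace ℝ (Fin 3) ≃ₗᵢ[ℝ] EuclideanSpace ℝ (Fin 3)),
    (∀ y : Fin n → EuclideanSpace ℝ (Fin 3), F (fun i => R (y i)) = F y) →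
    ∀ (b : EuclideanSpace ℝ (Fin 3)) (x : Fin n → EuclideanSpace ℝ (Fin 3)),
    fderiv ℝ F (fun i => R (x i)) (fun i => ‖R (x i)‖ ^ 2 • R b - (2 * inner ℝ (R b) (R (x i))) • R (x i)) -
        2 * Δ * (∑ i, inner ℝ (R b) (R (x i))) * F (fun i => R (x i)) =
      fderiv ℝ F x (fun i => ‖x i‖ ^ 2 • b - (2 * inner ℝ b (x i)) • x i) - 2 * Δ * (∑ i, inner ℝ b (x i)) * F x := by
  intro n F Δ R hF b x
  -- the diagonal action of `R` as a continuous linear equivalence of the configuration space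
  obtain ⟨Rhat, hRhat⟩ :
      ∃ Rhat : (Fin n → EuclideanSpace ℝ (Fin 3)) ≃L[ℝ] (Fin n → EuclideanSpace ℝ (Fin 3)),
        ∀ y, Rhat y = fun i => R (y i) :=
    ⟨ContinuousLinearEquiv.piCongrRight fun _ => R.toContinuousLinearEquiv, fun _ => rfl⟩
  have hcomp : F ∘ Rhat = F := funext fun y => by rw [Function.comp_apply, hRhat, hF]
  -- chain rule through `Rhat` (valid without differentiability: both sides are `0` otherwise)
  have hchain : fderiv ℝ F x = (fderiv ℝ F (Rhat x)).comp (Rhat : _ →L[ℝ] _) := by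
    have h := Rhat.comp_right_fderiv (𝕜 := ℝ) (f := F) (x := x)
    rwa [hcomp] at h
  have hderiv : fderiv ℝ F (fun i => R (x i))
      (fun i => ‖R (x i)‖ ^ 2 • R b - (2 * inner ℝ (R b) (R (x i))) • R (x i)) =
      fderiv ℝ F x (fun i => ‖x i‖ ^ 2 • b - (2 * inner ℝ b (x i)) • x i) := by
    rw [hchain, ContinuousLinearMap.comp_apply, ContinuousLinearEquiv.coe_coe, hRhat, hRhat]
    congr 1
    funext i
    rw [LinearIsometryEquiv.map_sub, LinearIsometryEquiv.map_smul, LinearIsometryEquiv.map_smul,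
      LinearIsometryEquiv.norm_map, LinearIsometryEquiv.inner_map_map]
  rw [hderiv, hF x]
  simp only [LinearIsometryEquiv.inner_map_map]

end Summit.CriticalPhenomena.Ising3DConformalLimit.MoebiusLimitExistsSketchV16
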